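import Mathlib.GroupTheory.Torsion
import Mathlib.RingTheory.RootsOfUnity.Basic
import Mathlib.GroupTheory.QuotientGroup.Defs
import Mathlib.Algebra.Group.Units.Equiv
import HarnessLib

/-!
# [IUTchII] Definition 4.9 (i): unit quotients `O^{×μ_N}`, `O^{×μ}`, isometries, and
# `×`- and `×μ`-Kummer structures

S. Mochizuki, *Inter-universal Teichmüller theory II: Hodge–Arakelov-theoretic evaluation*,
§4 "Global Gaussian Frobenioids", Definition 4.9 (i) (kurims Dec-2020 manuscript p. 154;
PRIMS **57** (2021)) [cite: Mochizuki2012, Def 4.9 (i) p.154]. Claim key, status DISPUTED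
(D-0012): this file records DEFINITIONS and Prop-valued statements only; nothing here asserts
any disputed claim.

**What is printed (p. 154).** For a Frobenioid `C` whose base category is the category of
connected finite étale coverings of the spectrum of an MLF or CAF, a universal covering
pro-object `A`, `G := Aut(A)`, one has the monoid `G ↷ O^▷(A)`; `μ_N(A) ⊆ O^μ(A) ⊆ O^×(A)` are
the `N`-torsion / torsion subgroups of the units; `O^×(A) ↠ O^{×μ_N}(A) ↠ O^{×μ}(A)` the
quotients. A `×`-Kummer structure (resp. `×μ`-Kummer structure) on `C` is a `Ẑ^×`- (resp.
`Ism`-) orbit of isomorphisms `κ^× : O^×(G) ⥲ O^×(A)` (resp. `κ^{×μ} : O^{×μ}(G) ⥲ O^{×μ}(A)`)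
of ind-topological `G`-modules; `I^κ_H(A) := Im(O^×(G)^H) ⊆ O^{×μ}(A)`; "it is essentially a
tautology that the `×μ`-Kummer structure `κ^{×μ}` on `C` is completely determined by the
submodules `{I^κ_H(A)}_H`". `Ism(G)` is the group of `G`-isometries of `O^{×μ}(G)`:
`G`-equivariant automorphisms preserving, for each open `H ⊆ G`, the lattice
`Im(O^×(G)^H) ⊆ O^{×μ}(G)^H` ([IUTchII] Example 1.8 (iv), p. 39).

**Dictionary (real Mathlib algebra).** `O^▷(A)` = a `CommMonoid O`; `O^×(A) = Oˣ`;
`μ_N(A) = rootsOfUnity N O`; `O^μ(A) = CommGroup.torsion Oˣ`; `O^{×μ_N}(A) = Oˣ ⧸ rootsOfUnity N O`;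
`O^{×μ}(A) = Oˣ ⧸ CommGroup.torsion Oˣ`. A continuous action is recorded as `ρ : G →* MulAut U`
(topologies SUPPRESSED at this statement level; said once here). `U^H = fixedBy ρ H`; the
lattice `Im(U^H) ⊆ U^{×μ}` = `invariantLattice`; `Ism = isometryGroup ρ 𝓗`, `𝓗` = the open subgroups.
**Interfaces (flagged TODO-merge).** `G ↷ O^×(G)` of Example 1.8 (iii) with the image of `Ẑ^×`
(`GroupTheoreticUnits`; owners abc-iut-L6-t1 / abc-iut-L4-t1); the Frobenioid `C` enters only
through `G ↷ O^▷(A)` (`CoveringMonoid`; owners abc-iut-L1-*, abc-iut-L5-t2).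
**Proved here.** The printed tautology "`κ^{×μ}` is completely determined by `{I^κ_H(A)}_H`"
(`sameIsmOrbit_iff_invariantImage_eq`). NOT here: Def 4.9 (ii)–(viii) (separate file); the
uniqueness of `×`-Kummer structures (Remark 1.11.1 (b); named statement `KummerTimesUnique`).
-/

namespace Literature.IUT.HodgeArakelov

universe u v w

/-! ### 1. Units, torsion, and the quotients `O^{×μ_N}`, `O^{×μ}` (Def 4.9 (i), p. 154) -/

section Quotients

variable (U : Type u) [CommGroup U]

/-- `U^{μ}`: the torsion subgroup of a commutative group `U` (for `U = O^×(A)` this is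
`O^μ(A)`, "torsion elements of arbitrary order", [IUTchII] Def 4.9 (i) p. 154); Mathlib's
`CommGroup.torsion`. [cite: Mochizuki2012, Def 4.9 (i) p.154] -/
abbrev torsionPart : Subgroup U := CommGroup.torsion U

/-- `U^{×μ} := U / U^{μ}`: a commutative group modulo its torsion (for `U = O^×(A)` this is
`O^{×μ}(A) := O^×(A)/O^μ(A)`, [IUTchII] Def 4.9 (i) p. 154; Example 1.8 (iv) p. 38).
[cite: Mochizuki2012, Def 4.9 (i) p.154] -/
abbrev ModTorsion : Type u := U ⧸ CommGroup.torsion U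

variable (O : Type u) [CommMonoid O]

/-- `μ_N(A) ⊆ O^×(A)`: the subgroup of `N`-torsion units of the monoid `O = O^▷(A)`
([IUTchII] Def 4.9 (i) p. 154, "[cf. [FrdII], Definition 2.1, (i)]"); Mathlib's
`rootsOfUnity N O`. [cite: Mochizuki2012, Def 4.9 (i) p.154] -/
abbrev unitRoots (N : ℕ) : Subgroup Oˣ := rootsOfUnity N O

/-- `O^{×μ_N}(A) := O^×(A)/μ_N(A)` ([IUTchII] Def 4.9 (i) p. 154).
[cite: Mochizuki2012, Def 4.9 (i) p.154] -/
abbrev UnitsModRoots (N : ℕ) : Type u := Oˣ ⧸ rootsOfUnity N O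

/-- `O^{×μ}(A) := O^×(A)/O^μ(A)` ([IUTchII] Def 4.9 (i) p. 154).
[cite: Mochizuki2012, Def 4.9 (i) p.154] -/
abbrev UnitsModTorsion : Type u := ModTorsion Oˣ

/-- `μ_N(A) ⊆ O^μ(A)` for `N ≥ 1` ([IUTchII] Def 4.9 (i) p. 154).
[cite: Mochizuki2012, Def 4.9 (i) p.154] -/
theorem unitRoots_le_torsion (N : ℕ) [NeZero N] :
    rootsOfUnity N O ≤ CommGroup.torsion Oˣ := by
  intro ζ hζ
  rw [CommGroup.mem_torsion, isOfFinOrder_iff_pow_eq_one]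
  exact ⟨N, Nat.pos_of_ne_zero (NeZero.ne N), (mem_rootsOfUnity N ζ).mp hζ⟩

/-- The second surjection `O^{×μ_N}(A) ↠ O^{×μ}(A)` of [IUTchII] Def 4.9 (i) p. 154 (the
first, `O^×(A) ↠ O^{×μ_N}(A)`, is `QuotientGroup.mk'`). [cite: Mochizuki2012, Def 4.9 (i) p.154] -/
def unitsModRootsToModTorsion (N : ℕ) [NeZero N] :
    UnitsModRoots O N →* UnitsModTorsion O :=
  QuotientGroup.map _ _ (MonoidHom.id _)
    (by simpa only [Subgroup.comap_id] using unitRoots_le_torsion O N)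

/-- `O^{×μ_N}(A) ↠ O^{×μ}(A)` is surjective ([IUTchII] Def 4.9 (i) p. 154).
[cite: Mochizuki2012, Def 4.9 (i) p.154] -/
theorem unitsModRootsToModTorsion_surjective (N : ℕ) [NeZero N] :
    Function.Surjective (unitsModRootsToModTorsion O N) := by
  intro x
  induction x using QuotientGroup.induction_on with
  | H z => exact ⟨QuotientGroup.mk z, rfl⟩

end Quotients

/-! ### 2. Actions, invariants, equivariant isomorphisms -/

section Actions

variable {G : Type u} [Group G] {U : Type v} [CommGroup U] {V : Type w} [CommGroup V]

/-- `U^H`: the subgroup of `H`-invariants of a `G`-module `ρ : G →* MulAut U` (the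
"superscript `H`" of [IUTchII] Def 4.9 (i) p. 154 / Example 1.8 (iv) p. 39).
[cite: Mochizuki2012, Def 4.9 (i) p.154] -/
def fixedBy (ρ : G →* MulAut U) (H : Subgroup G) : Subgroup U where
  carrier := {u | ∀ h ∈ H, ρ h u = u}
  one_mem' := fun h _ => map_one (ρ h)
  mul_mem' := fun {a b} ha hb h hh => by
    simp only [Set.mem_setOf_eq] at ha hb ⊢
    rw [map_mul, ha h hh, hb h hh]
  inv_mem' := fun {a} ha h hh => by
    simp only [Set.mem_setOf_eq] at ha ⊢
    rw [map_inv, ha h hh]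

/-- Membership in `U^H`. [cite: Mochizuki2012, Def 4.9 (i) p.154] -/
theorem mem_fixedBy (ρ : G →* MulAut U) (H : Subgroup G) (u : U) :
    u ∈ fixedBy ρ H ↔ ∀ h ∈ H, ρ h u = u := Iff.rfl

/-- A `G`-equivariant isomorphism of `G`-modules `(U, ρ) ⥲ (V, σ)` ("isomorphism of
[ind-topological] `G`-modules", [IUTchII] Def 4.9 (i) p. 154; topologies suppressed).
[cite: Mochizuki2012, Def 4.9 (i) p.154] -/
structure EquivariantIso (ρ : G →* MulAut U) (σ : G →* MulAut V) where
  /-- the underlying isomorphism of groups -/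
  toMulEquiv : U ≃* V
  /-- equivariance -/
  map_act : ∀ (g : G) (u : U), toMulEquiv (ρ g u) = σ g (toMulEquiv u)

/-- An automorphism of `U` descends to `U^{×μ} = U/U^μ` (torsion is characteristic).
[cite: Mochizuki2012, Def 4.9 (i) p.154] -/
def MulEquivModTorsion (φ : U ≃* V) : ModTorsion U ≃* ModTorsion V :=
  QuotientGroup.congr _ _ φ φ.map_torsion

/-- The descended isomorphism on classes. [cite: Mochizuki2012, Def 4.9 (i) p.154] -/
@[simp] theorem mulEquivModTorsion_mk (φ : U ≃* V) (u : U) :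
    MulEquivModTorsion φ (QuotientGroup.mk u) = QuotientGroup.mk (φ u) :=
  QuotientGroup.congr_mk _ _ φ φ.map_torsion u

/-- The `G`-action induced on `U^{×μ}` by a `G`-action on `U` ("`O^{×μ}(A)` … equipped with
natural `G`-actions", [IUTchII] Def 4.9 (i) p. 154). [cite: Mochizuki2012, Def 4.9 (i) p.154] -/
def actionModTorsion (ρ : G →* MulAut U) : G →* MulAut (ModTorsion U) where
  toFun g := MulEquivModTorsion (ρ g)
  map_one' := by
    apply MulEquiv.ext
    intro x
    induction x using QuotientGroup.induction_on with
    | H z => simp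
  map_mul' g g' := by
    apply MulEquiv.ext
    intro x
    induction x using QuotientGroup.induction_on with
    | H z => simp

/-- The descended action on classes. [cite: Mochizuki2012, Def 4.9 (i) p.154] -/
@[simp] theorem actionModTorsion_mk (ρ : G →* MulAut U) (g : G) (u : U) :
    actionModTorsion ρ g (QuotientGroup.mk u) = QuotientGroup.mk (ρ g u) :=
  mulEquivModTorsion_mk (ρ g) u

/-- The lattice `Im(U^H) ⊆ U^{×μ}` determined by the image of the `H`-invariants
([IUTchII] Example 1.8 (iv) p. 39, "the «lattice» in `O^{×μ}(G)^H` determined by the image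
of `O^×(G)^H`"; Def 4.9 (i) p. 154). [cite: Mochizuki2012, Def 4.9 (i) p.154] -/
def invariantLattice (ρ : G →* MulAut U) (H : Subgroup G) : Subgroup (ModTorsion U) :=
  (fixedBy ρ H).map (QuotientGroup.mk' (CommGroup.torsion U))

/-- `Ism`: the group of `G`-isometries of `U^{×μ}` relative to a family `𝓗` of ("open")
subgroups of `G` — `G`-equivariant automorphisms of `U^{×μ}` that preserve the lattice
`Im(U^H)` for every `H ∈ 𝓗` ([IUTchII] Example 1.8 (iv) p. 39; used in Def 4.9 (i) p. 154).
-- TODO-merge: abc-iut-L6-t1 owns Example 1.8 (iv); this is the algebraic shadow needed here.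
[cite: Mochizuki2012, Def 4.9 (i) p.154] -/
def isometryGroup (ρ : G →* MulAut U) (𝓗 : Set (Subgroup G)) :
    Subgroup (MulAut (ModTorsion U)) where
  carrier := {φ | (∀ g : G, φ * actionModTorsion ρ g = actionModTorsion ρ g * φ) ∧
    ∀ H ∈ 𝓗, (invariantLattice ρ H).map φ.toMonoidHom = invariantLattice ρ H}
  one_mem' := by
    refine ⟨fun g => by rw [one_mul, mul_one], fun H _ => ?_⟩
    exact Subgroup.map_id _
  mul_mem' := fun {φ ψ} hφ hψ => by
    refine ⟨fun g => ?_, fun H hH => ?_⟩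
    · rw [mul_assoc, hψ.1 g, ← mul_assoc, hφ.1 g, mul_assoc]
    · have : (φ * ψ).toMonoidHom = φ.toMonoidHom.comp ψ.toMonoidHom := rfl
      rw [this, ← Subgroup.map_map, hψ.2 H hH, hφ.2 H hH]
  inv_mem' := fun {φ} hφ => by
    refine ⟨fun g => ?_, fun H hH => ?_⟩
    · have h := hφ.1 g
      calc φ⁻¹ * actionModTorsion ρ g
          = φ⁻¹ * (actionModTorsion ρ g * φ) * φ⁻¹ := by group
        _ = φ⁻¹ * (φ * actionModTorsion ρ g) * φ⁻¹ := by rw [h]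
        _ = actionModTorsion ρ g * φ⁻¹ := by group
    · have hmap := hφ.2 H hH
      conv_lhs => rw [← hmap]
      rw [Subgroup.map_map]
      have : φ⁻¹.toMonoidHom.comp φ.toMonoidHom = MonoidHom.id _ := by
        ext x; simp
      rw [this, Subgroup.map_id]

/-- Membership in `Ism`. [cite: Mochizuki2012, Def 4.9 (i) p.154] -/
theorem mem_isometryGroup (ρ : G →* MulAut U) (𝓗 : Set (Subgroup G))
    (φ : MulAut (ModTorsion U)) :
    φ ∈ isometryGroup ρ 𝓗 ↔ (∀ g : G, φ * actionModTorsion ρ g = actionModTorsion ρ g * φ) ∧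
      ∀ H ∈ 𝓗, (invariantLattice ρ H).map φ.toMonoidHom = invariantLattice ρ H := Iff.rfl

end Actions

/-! ### 3. Interfaces: the data Definition 4.9 (i) starts from -/

/-- INTERFACE (owner abc-iut-L1-*/L5-t2; [FrdI] Prop 2.2, [IUTchI] Ex 3.2 (ii)): what
Definition 4.9 (i) uses of the Frobenioid `C` — the group `G = Aut(A)` of a universal covering
pro-object `A` of the base category and the monoid `O^▷(A)` "equipped with a natural action
by `G`" obtained "by evaluating the monoid `O^▷(−)` on `D` … at `A`" (p. 154). Topologies
suppressed. -- TODO-merge: abc-iut-L5-t2 (tempered/`p_v`-adic Frobenioids of [IUTchI] Ex 3.2–3.4).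
[cite: Mochizuki2012, Def 4.9 (i) p.154] -/
structure CoveringMonoid (G : Type u) [Group G] where
  /-- the monoid `O^▷(A)` -/
  O : Type v
  /-- it is a commutative monoid -/
  [isCommMonoid : CommMonoid O]
  /-- the natural action `G ↷ O^▷(A)` by monoid automorphisms -/
  act : G →* MulAut O

attribute [instance] CoveringMonoid.isCommMonoid

namespace CoveringMonoid

variable {G : Type u} [Group G] (M : CoveringMonoid.{u, v} G)

/-- The induced action `G ↷ O^×(A)` on units ([IUTchII] Def 4.9 (i) p. 154: "`O^×(A)` … all
equipped with natural `G`-actions"). [cite: Mochizuki2012, Def 4.9 (i) p.154] -/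
def unitsAct : G →* MulAut M.Oˣ where
  toFun g := Units.mapEquiv (M.act g)
  map_one' := by ext u; simp [Units.coe_mapEquiv]
  map_mul' g g' := by ext u; simp [Units.coe_mapEquiv]

/-- The induced action `G ↷ O^{×μ}(A)` ([IUTchII] Def 4.9 (i) p. 154).
[cite: Mochizuki2012, Def 4.9 (i) p.154] -/
def unitsModTorsionAct : G →* MulAut (UnitsModTorsion M.O) := actionModTorsion M.unitsAct

end CoveringMonoid

/-- INTERFACE (owner abc-iut-L6-t1, [IUTchII] Example 1.8 (iii)–(iv) pp. 37–39; ultimately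
[AbsTopIII] Cor 1.10 via abc-iut-L4-t1): the OUTPUT of the group-theoretic algorithm
`G ↦ (G ↷ O^×(G))` for `G` "nontrivial [i.e., arises from an MLF]" (p. 154), together with
(a) the family of open subgroups of `G` indexing the invariants `O^×(G)^H` and (b) the image
of `Ẑ^×` in the automorphisms of the topological `Ẑ`-module `O^×(G)` (Mathlib has no `Ẑ`;
recorded as a subgroup commuting with `G`). -- TODO-merge: abc-iut-L6-t1 / abc-iut-L4-t1.
[cite: Mochizuki2012, Def 4.9 (i) p.154] -/
structure GroupTheoreticUnits (G : Type u) [Group G] where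
  /-- the module `O^×(G)` -/
  OxG : Type v
  /-- it is a commutative group -/
  [isCommGroup : CommGroup OxG]
  /-- the natural `G`-action -/
  act : G →* MulAut OxG
  /-- the open subgroups `H ⊆ G` (profinite topology suppressed: given as a family) -/
  openSubgroups : Set (Subgroup G)
  /-- the image `Im(Ẑ^×) ⊆ Aut(O^×(G))` -/
  zhatUnits : Subgroup (MulAut OxG)
  /-- `Ẑ^×` acts `G`-equivariantly -/
  zhatUnits_comm : ∀ γ ∈ zhatUnits, ∀ g : G, γ * act g = act g * γ

attribute [instance] GroupTheoreticUnits.isCommGroup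

/-! ### 4. Definition 4.9 (i): `×`- and `×μ`-Kummer structures (p. 154–155) -/

section KummerStructures

variable {G : Type u} [Group G]

/-- A **`×`-Kummer structure** on `C` ([IUTchII] Def 4.9 (i) p. 154): "a `Ẑ^×`-orbit of
isomorphisms `κ^× : O^×(G) ⥲ O^×(A)` of ind-topological `G`-modules" — recorded as the SET of
members of the orbit together with the orbit property. [cite: Mochizuki2012, Def 4.9 (i) p.154] -/
structure KummerTimes (X : GroupTheoreticUnits.{u, v} G) (M : CoveringMonoid.{u, w} G) where
  /-- the members `κ^×` of the orbit -/
  orbit : Set (EquivariantIso X.act M.unitsAct)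
  /-- it is one `Ẑ^×`-orbit: nonempty, and `κ' ∈ orbit ↔ κ' = κ ∘ γ` for some `γ ∈ Im(Ẑ^×)` -/
  isOrbit : ∃ κ ∈ orbit, ∀ κ' : EquivariantIso X.act M.unitsAct,
    κ' ∈ orbit ↔ ∃ γ ∈ X.zhatUnits, κ'.toMulEquiv = γ.trans κ.toMulEquiv

/-- A **`×μ`-Kummer structure** on `C` ([IUTchII] Def 4.9 (i) p. 154): "an `Ism`-orbit of
isomorphisms `κ^{×μ} : O^{×μ}(G) ⥲ O^{×μ}(A)` of ind-topological `G`-modules", `Ism = Ism(G)`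
the `G`-isometries of `O^{×μ}(G)` for the family of open subgroups.
[cite: Mochizuki2012, Def 4.9 (i) p.154] -/
structure KummerTimesMu (X : GroupTheoreticUnits.{u, v} G) (M : CoveringMonoid.{u, w} G) where
  /-- the members `κ^{×μ}` of the orbit -/
  orbit : Set (EquivariantIso (actionModTorsion X.act) M.unitsModTorsionAct)
  /-- it is one `Ism`-orbit -/
  isOrbit : ∃ κ ∈ orbit, ∀ κ' : EquivariantIso (actionModTorsion X.act) M.unitsModTorsionAct,
    κ' ∈ orbit ↔ ∃ γ ∈ isometryGroup X.act X.openSubgroups,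
      κ'.toMulEquiv = γ.trans κ.toMulEquiv

/-- `I^κ_H(A) := Im(O^×(G)^H) ⊆ O^{×μ}(A)` — "the image via `κ^{×μ}` of the image of `O^×(G)^H`
in `O^{×μ}(G)^H`" ([IUTchII] Def 4.9 (i) p. 154), for one member `κ` of the orbit.
[cite: Mochizuki2012, Def 4.9 (i) p.154] -/
def invariantImage (X : GroupTheoreticUnits.{u, v} G) {V : Type w} [CommGroup V]
    {σ : G →* MulAut V} (κ : EquivariantIso (actionModTorsion X.act) σ) (H : Subgroup G) :
    Subgroup V :=
  (invariantLattice X.act H).map κ.toMulEquiv.toMonoidHom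

/-- **The printed tautology, proved** ([IUTchII] Def 4.9 (i) p. 154: "the `×μ`-Kummer
structure `κ^{×μ}` on `C` is completely determined by the submodules `{I^κ_H(A) ⊆ O^{×μ}(A)}_H`
… namely, as the unique `Ism`-orbit of `G`-equivariant isomorphisms … that maps `O^×(G)^H`
onto `I^κ_H(A)` for each open subgroup `H ⊆ G`"): two `G`-equivariant isomorphisms
`O^{×μ}(G) ⥲ V` differ by an element of `Ism` iff they have the same images of all the
lattices `Im(O^×(G)^H)`, `H` open. [cite: Mochizuki2012, Def 4.9 (i) p.154] -/
theorem sameIsmOrbit_iff_invariantImage_eq (X : GroupTheoreticUnits.{u, v} G)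
    {V : Type w} [CommGroup V] {σ : G →* MulAut V}
    (κ κ' : EquivariantIso (actionModTorsion X.act) σ) :
    (∃ γ ∈ isometryGroup X.act X.openSubgroups, κ'.toMulEquiv = γ.trans κ.toMulEquiv) ↔
      ∀ H ∈ X.openSubgroups, invariantImage X κ' H = invariantImage X κ H := by
  constructor
  · rintro ⟨γ, hγ, hκ'⟩ H hH
    unfold invariantImage
    have hcomp : (γ.trans κ.toMulEquiv).toMonoidHom =
        κ.toMulEquiv.toMonoidHom.comp γ.toMonoidHom := by
      ext x; rfl
    rw [hκ', hcomp, ← Subgroup.map_map, hγ.2 H hH]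
  · intro hI
    -- the candidate isometry `γ := κ⁻¹ ∘ κ'`
    let γ : MulAut (ModTorsion X.OxG) := κ'.toMulEquiv.trans κ.toMulEquiv.symm
    have hγκ : κ'.toMulEquiv = γ.trans κ.toMulEquiv := by
      apply MulEquiv.ext; intro x; simp [γ]
    refine ⟨γ, ⟨fun g => ?_, fun H hH => ?_⟩, hγκ⟩
    · -- equivariance of `γ` from that of `κ`, `κ'`
      apply MulEquiv.ext
      intro x
      simp only [MulAut.mul_apply]
      change κ.toMulEquiv.symm (κ'.toMulEquiv (actionModTorsion X.act g x)) =
        actionModTorsion X.act g (κ.toMulEquiv.symm (κ'.toMulEquiv x))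
      rw [κ'.map_act g x]
      apply κ.toMulEquiv.injective
      rw [MulEquiv.apply_symm_apply, κ.map_act g, MulEquiv.apply_symm_apply]
    · -- lattice preservation from `I^κ'_H = I^κ_H`
      have h := hI H hH
      unfold invariantImage at h
      have hγ' : γ.toMonoidHom =
          κ.toMulEquiv.symm.toMonoidHom.comp κ'.toMulEquiv.toMonoidHom := rfl
      rw [hγ', ← Subgroup.map_map, h, Subgroup.map_map]
      have : κ.toMulEquiv.symm.toMonoidHom.comp κ.toMulEquiv.toMonoidHom = MonoidHom.id _ := by
        ext x; simp
      rw [this, Subgroup.map_id]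

/-- NAMED STATEMENT (not proved here): "any `×`-Kummer structure on `C` is unique"
([IUTchII] Def 4.9 (i) p. 154, recalling Remark 1.11.1 (b), itself resting on [AbsTopIII]
Prop 3.3 (ii)) — any two `×`-Kummer structures have the same orbit.
-- TODO-merge: abc-iut-L6-t1 (Remark 1.11.1 (b)) supplies the statement this abbreviates.
[cite: Mochizuki2012, Def 4.9 (i) p.154] -/
def KummerTimesUnique (X : GroupTheoreticUnits.{u, v} G) (M : CoveringMonoid.{u, w} G) : Prop :=
  ∀ κ₁ κ₂ : KummerTimes X M, κ₁.orbit = κ₂.orbit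

/-- A **[`×`-]Kummer Frobenioid** ([IUTchII] Def 4.9 (i) p. 155: "any Frobenioid equipped with a
`×`-Kummer structure"), at the level of the data Definition 4.9 (i) sees: the covering monoid
of `C` together with a `×`-Kummer structure. [cite: Mochizuki2012, Def 4.9 (i) p.155] -/
structure KummerTimesFrobenioid (X : GroupTheoreticUnits.{u, v} G) where
  /-- `G ↷ O^▷(A)` of the Frobenioid -/
  monoid : CoveringMonoid.{u, w} G
  /-- its `×`-Kummer structure -/
  kummer : KummerTimes X monoid

/-- A **[`×μ`-]Kummer Frobenioid** ([IUTchII] Def 4.9 (i) p. 155), at the same level.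
[cite: Mochizuki2012, Def 4.9 (i) p.155] -/
structure KummerTimesMuFrobenioid (X : GroupTheoreticUnits.{u, v} G) where
  /-- `G ↷ O^▷(A)` of the Frobenioid -/
  monoid : CoveringMonoid.{u, w} G
  /-- its `×μ`-Kummer structure -/
  kummer : KummerTimesMu X monoid

/-- INTERFACE for "split Frobenioid" as used from Definition 4.9 (ii) on ([IUTchI] Ex 3.2 (v),
Def 5.2 (ii): a Frobenioid "equipped with a splitting", whose image in `O^▷(A)` is what
Definition 4.9 (ii)–(iv) uses: "the images of the splittings with which `‡F^⊢_w` is equipped").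
Recorded as the covering monoid plus the image submonoid of the splitting.
-- TODO-merge: abc-iut-L5-t2 / abc-iut-L5-t4 ([IUTchI] Ex 3.2 (v), Def 5.2 (ii)).
[cite: Mochizuki2012, Def 4.9 (ii) p.155] -/
structure SplitCoveringMonoid (G : Type u) [Group G] extends CoveringMonoid.{u, v} G where
  /-- the image in `O^▷(A)` of the splitting(s) of the split Frobenioid -/
  splittingImage : Submonoid O

/-- A **split-[`×`-]Kummer Frobenioid** ([IUTchII] Def 4.9 (i) p. 155: "any split Frobenioid
equipped with a `×`-Kummer structure"). [cite: Mochizuki2012, Def 4.9 (i) p.155] -/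
structure SplitKummerTimesFrobenioid (X : GroupTheoreticUnits.{u, v} G) where
  /-- the split Frobenioid data -/
  monoid : SplitCoveringMonoid.{u, w} G
  /-- its `×`-Kummer structure -/
  kummer : KummerTimes X monoid.toCoveringMonoid

/-- A **split-[`×μ`-]Kummer Frobenioid** ([IUTchII] Def 4.9 (i) p. 155).
[cite: Mochizuki2012, Def 4.9 (i) p.155] -/
structure SplitKummerTimesMuFrobenioid (X : GroupTheoreticUnits.{u, v} G) where
  /-- the split Frobenioid data -/
  monoid : SplitCoveringMonoid.{u, w} G
  /-- its `×μ`-Kummer structure -/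
  kummer : KummerTimesMu X monoid.toCoveringMonoid

end KummerStructures

end Literature.IUT.HodgeArakelov
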